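import Literature.NumberTheory.EllipticCurves.NewformGaloisRepModLOfWeightOneProofs
import Literature.NumberTheory.GaloisRepresentations.ResidualGaloisRep
import Literature.NumberTheory.GaloisRepresentations.IntegralGaloisActionProofs
import Mathlib.FieldTheory.IsAlgClosed.Classification
import Mathlib.Analysis.Complex.Cardinality
import Mathlib.Topology.Algebra.Module.Cardinality
import Mathlib.RingTheory.Algebraic.Cardinality
import Mathlib.RingTheory.Valuation.Integral
import HarnessLib

/-!
# Deligne–Serre 1974, Thm. 6.7 in weight one from Deligne's theorem in `ℚ̄_ℓ`-form

A proofs-only companion (theorems only: no definitions, no named facts; D-0026) of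
`Literature/NumberTheory/EllipticCurves/NewformGaloisRepModL.lean`, written by the seat of its
named fact `Literature.NumberTheory.EllipticCurves.ModularForms.DeligneSerre1974.thm67_weightOne`
(Deligne–Serre 1974, Thm. 6.7 for a weight-one newform `f ∈ S_1(Γ₁(N))` and `ι : 𝓞_f → 𝔽_ℓ`).

The printed proof of Thm. 6.7 (op. cit. 6.8–6.13) is proved in the tree modulo its one external
input, Deligne's Thm. 6.1 — the `λ`-adic representation `ρ_{g,λ} : Gal(ℚ̄/ℚ) → GL₂(K_λ)` of an
eigenform `g` of weight `≥ 2` at **every** finite place `λ` of its coefficient field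
(`NewformGaloisRepModLProofs.thm67_weightOne_of_thm61`,
`DeligneSerreWeightOneOfThm67.thm67_weightOne_of_deligneThm61`). The tree's Langlands cone speaks
of these representations in a different language: over `ℚ̄_ℓ`, indexed by field isomorphisms
`ι : ℚ̄_ℓ ≃ ℂ` (`Literature.NumberTheory.Automorphic.exists_galoisRep_of_regularAlgebraic`,
lang.S27 = Harris–Lan–Taylor–Thorne, Thm. A, with `arithFrobPolyOfSatake ι`; for `n = 2`, `K = ℚ`
and holomorphic `π` this is Deligne's theorem). This file proves Thm. 6.7 in weight one from
Deligne's theorem **in that `ℚ̄_ℓ`-form** (`thm67_weightOne_of_deligne_padicAlgCl'`): for every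
cuspidal eigenform `g ∈ S_k(Γ₁(M), χ)`, `k ≥ 2`, of the `T_p` (`p ∤ M`) with eigenvalues
`a_p ∈ ℂ`, every `ℓ` and every `ι : ℚ̄_ℓ ≃+* ℂ`, a continuous semisimple
`r : Gal(ℚ̄/ℚ) → GL₂(ℚ̄_ℓ)` unramified at `p ∤ M`, `p ≠ ℓ`, with
`det(X - r(Frob_p)) = X² - ι⁻¹(a_p) X + ι⁻¹(χ(p) p^{k-1})` (arithmetic Frobenius). So the named
fact is now closed modulo Deligne's theorem in either form, and — once holomorphic newforms are
read as regular algebraic cuspidal automorphic representations of `GL₂(𝔸_ℚ)` with their Satake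
parameters — modulo lang.S27.

The passage from "every `ι`" to "the place `λ ∣ ℓ` of the lift produced by 6.8–6.11" needs two
lemmas of independent interest, proved here:

* `exists_ringHom_padicAlgCl_of_heightOneSpectrum` — **every prime `v ∣ ℓ` of a number field
  `K` is induced by an embedding `j : K → ℚ̄_ℓ`** (`j(𝓞 K) ⊆ ℤ̄_ℓ`, `j⁻¹(𝔪) ∩ 𝓞 K = v`): embed
  `K ⊂ ℚ̄ ⊂ ℚ̄_ℓ`; the prime `𝔪 ∩ ℤ̄` and a prime of `ℤ̄` above `v` both lie over `(ℓ)`, hence are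
  conjugate under `Gal(ℚ̄/ℚ)` (the tree's `exists_smul_eq_of_mem_primesAbove_holds`, Neukirch I
  (9.1)); twist the embedding by that automorphism;
* `exists_ringEquiv_padicAlgCl_complex_extends` — **Steinitz over `K`**: embeddings
  `j : K → ℚ̄_ℓ`, `e : K → ℂ` of a number field extend to `ι : ℚ̄_ℓ ≃+* ℂ` with `ι ∘ j = e`
  (transcendence bases over `K` of two algebraically closed fields of cardinality `𝔠`, Mathlib
  `IsAlgClosed.equivOfTranscendenceBasis` made `K`-linear);
* `valued_le_one_iff_valuation_le_one`, `valued_lt_one_iff_valuation_lt_one` — such a `j`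
  pulls the valuation ring of `ℚ̄_ℓ` back to the valuation ring of `v` (a discrete valuation
  ring is a maximal proper subring, Mathlib `ValuationSubring.eq_of_le_of_ne_top`);
* `thm67_weightOne_core_padicAlgCl` — op. cit. **6.12–6.13 over `ℤ̄_ℓ`**: integral model of
  `r` over the open (non-Noetherian) valuation ring `ℤ̄_ℓ` (`exists_integralModel_of_valuationSubring`),
  reduction modulo `𝔪`, the congruences `b_p ≡ a_p(f)`, `p^{k'-1} ≡ 1 (mod ℓ)`, and
  `thm67_weightOne_of_residualModel` ((6.12.1) by Chebotarev, Lemme 6.13 over `ℤ̄_ℓ/𝔪 ⊇ 𝔽_ℓ`,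
  semisimplification);
* `thm67_weightOne_of_deligne_padicAlgCl`, `thm67_weightOne_of_deligne_padicAlgCl'` — the
  assembly (6.8–6.11 = `exists_eigenform_congr_of_weight_one`; Chebotarev and (2.7.2) discharged
  by the tree in the primed version).

## References

* P. Deligne, J.-P. Serre, *Formes modulaires de poids 1*, Ann. Sci. ÉNS (4) 7 (1974), Thm. 6.1
  (p. 520), Thm. 6.7 and 6.8–6.13 (pp. 521–523), §8.2. [DeligneSerreASENS1974]
* J. Neukirch, *Algebraic Number Theory* (1999), Ch. I §9, Prop. (9.1); Ch. II §3, §8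
  (extensions of valuations and embeddings into `ℚ̄_ℓ`). [NeukirchANT1999]
* E. Steinitz, *Algebraische Theorie der Körper*, J. reine angew. Math. 137 (1910)
  (classification of algebraically closed fields). [folklore]
* M. Harris, K.-W. Lan, R. Taylor, J. Thorne, *On the rigid cohomology of certain Shimura
  varieties*, Res. Math. Sci. 3 (2016), Thm. A (the `ℚ̄_ℓ`/`ι` normalisation). [HarrisLanTaylorThorneRMS2016]
-/

noncomputable section

open scoped MatrixGroups ModularForm NumberField Polynomial NNReal Pointwise

open CongruenceSubgroup IsLocalRing IsDedekindDomain Polynomial Cardinal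
  Rat.HeightOneSpectrum Field Literature.NumberTheory.GaloisRepresentations

namespace Literature.NumberTheory.EllipticCurves.ModularForms.DeligneSerre1974

universe u

/-! ### Extending `K ↪ ℚ̄_ℓ` and `K ↪ ℂ` to `ℚ̄_ℓ ≃ ℂ` -/

section Steinitz

/-- **Steinitz over a countable base**: two algebraically closed fields of cardinality `𝔠` which
are algebras over a countable field `K` are isomorphic *over `K`* (transcendence bases over `K`
have cardinality `𝔠` on both sides, `IsAlgClosed.cardinal_eq_cardinal_transcendence_basis_of_aleph0_lt`;
then `IsAlgClosure.equivOfEquiv` along the `K`-isomorphism of the purely transcendental parts).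
Steinitz 1910; cf. Mathlib `IsAlgClosed.ringEquiv_of_equiv_of_charZero` (the case `K = ℚ`). [folklore] -/
theorem exists_ringEquiv_comp_algebraMap_eq {K : Type} [Field K] (hK : #K ≤ ℵ₀)
    (L M : Type) [Field L] [Field M] [Algebra K L] [Algebra K M] [IsAlgClosed L] [IsAlgClosed M]
    (hL : #L = 𝔠) (hM : #M = 𝔠) :
    ∃ ι : L ≃+* M, ∀ x : K, ι (algebraMap K L x) = algebraMap K M x := by
  obtain ⟨s, hs⟩ := exists_isTranscendenceBasis K L
  obtain ⟨t, ht⟩ := exists_isTranscendenceBasis K M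
  have hsL : #L = #s := IsAlgClosed.cardinal_eq_cardinal_transcendence_basis_of_aleph0_lt' _ hs hK
      (by rw [hL]; exact aleph0_lt_continuum)
  have htM : #M = #t := IsAlgClosed.cardinal_eq_cardinal_transcendence_basis_of_aleph0_lt' _ ht hK
      (by rw [hM]; exact aleph0_lt_continuum)
  have hst : #s = #t := by rw [← hsL, ← htM, hL, hM]
  obtain ⟨e⟩ := Cardinal.eq.mp hst
  letI := IsAlgClosed.isAlgClosure_of_transcendence_basis _ hs
  letI := IsAlgClosed.isAlgClosure_of_transcendence_basis _ ht
  let f : Algebra.adjoin K (Set.range ((↑) : s → L)) ≃ₐ[K] Algebra.adjoin K (Set.range ((↑) : t → M)) :=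
    (hs.1.aevalEquiv.symm.trans (MvPolynomial.renameEquiv K e)).trans ht.1.aevalEquiv
  refine ⟨IsAlgClosure.equivOfEquiv L M f.toRingEquiv, fun x ↦ ?_⟩
  have h1 : algebraMap K L x = algebraMap (Algebra.adjoin K (Set.range ((↑) : s → L))) L
      (algebraMap K _ x) := (IsScalarTower.algebraMap_apply _ _ _ x)
  rw [h1, IsAlgClosure.equivOfEquiv_algebraMap]
  change algebraMap _ M (f (algebraMap K _ x)) = _
  rw [AlgEquiv.commutes]
  exact (IsScalarTower.algebraMap_apply _ _ _ x).symm

/-- **Embeddings of a number field into `ℚ̄_ℓ` and `ℂ` are intertwined by some `ℚ̄_ℓ ≃ ℂ`**: for a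
number field `K` with `j : K → ℚ̄_ℓ` and `e : K → ℂ` there is a field isomorphism `ι : ℚ̄_ℓ ≃ ℂ`
with `ι ∘ j = e` (Steinitz over `K`: `#ℚ̄_ℓ = #ℂ = 𝔠`, the tree's
`NumberField.cardinalMk_algebraicClosure_padic` (`PadicComplexEmbedding`) and Mathlib's
`Cardinal.mk_complex`). This is how a prescribed place `λ ∣ ℓ` of
`K ⊂ ℂ` is realised as "the place induced by `ι⁻¹`" in statements indexed by `ι : ℚ̄_ℓ ≃ ℂ`
(Harris–Lan–Taylor–Thorne 2016, Introduction; Buzzard–Gee 2014, §2.1). [folklore] -/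
theorem exists_ringEquiv_padicAlgCl_complex_extends {K : Type} [Field K] [NumberField K]
    {ℓ : ℕ} [Fact ℓ.Prime] (j : K →+* PadicAlgCl ℓ) (e : K →+* ℂ) :
    ∃ ι : PadicAlgCl ℓ ≃+* ℂ, ∀ x : K, ι (j x) = e x := by
  letI : Algebra K (PadicAlgCl ℓ) := j.toAlgebra
  letI : Algebra K ℂ := e.toAlgebra
  have hK : #K ≤ ℵ₀ := (Algebra.IsAlgebraic.cardinalMk_le_max ℚ K).trans (by simp)
  exact exists_ringEquiv_comp_algebraMap_eq hK (PadicAlgCl ℓ) ℂ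
    (NumberField.cardinalMk_algebraicClosure_padic ℓ) Cardinal.mk_complex

end Steinitz

/-! ### The place of a number field induced by an embedding into `ℚ̄_ℓ` -/

section Place

variable {K : Type} [Field K] [NumberField K] {ℓ : ℕ} [Fact ℓ.Prime]

/-- **An embedding inducing `v` pulls `ℤ̄_ℓ` back to `𝒪_v`.** If `j : K → ℚ̄_ℓ` maps `𝓞 K`
into `ℤ̄_ℓ` with `j⁻¹(𝔪) ∩ 𝓞 K = v` (`v ∋ ℓ`), then `|j x| ≤ 1 ↔ v(x) ≤ 1` for all `x ∈ K`:
the pulled-back valuation ring contains `(𝓞 K)_v` and is proper (`ℓ⁻¹ ∉`), and a discrete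
valuation ring is a maximal proper subring (Mathlib `ValuationSubring.eq_of_le_of_ne_top`,
`HeightOneSpectrum.valuationSubringAtPrime_eq_valuationSubring`; cf. Neukirch II (3.8), (8.1)).
[cite: NeukirchANT1999, Ch. II (8.1)] -/
theorem valued_le_one_iff_valuation_le_one (j : K →+* PadicAlgCl ℓ) (v : HeightOneSpectrum (𝓞 K))
    (hℓv : ((ℓ : ℕ) : 𝓞 K) ∈ v.asIdeal)
    (hj : ∀ r : 𝓞 K, Valued.v (j r) ≤ 1) (hjv : ∀ r : 𝓞 K, Valued.v (j r) < 1 ↔ r ∈ v.asIdeal)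
    (x : K) : Valued.v (j x) ≤ 1 ↔ v.valuation K x ≤ 1 := by
  classical
  let w : Valuation K ℝ≥0 := (Valued.v : Valuation (PadicAlgCl ℓ) ℝ≥0).comap j
  let W : ValuationSubring K := w.valuationSubring
  have hW : ∀ y : K, y ∈ W ↔ Valued.v (j y) ≤ 1 := fun y ↦ Valuation.mem_valuationSubring_iff _ _
  have hℓ : ℓ.Prime := Fact.out
  -- `W ≠ ⊤`: `ℓ⁻¹ ∉ W`
  have hjℓ : Valued.v (j (ℓ : K)) < 1 := by
    have := (hjv (ℓ : 𝓞 K)).mpr hℓv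
    simpa using this
  have hℓ0 : (ℓ : K) ≠ 0 := Nat.cast_ne_zero.mpr hℓ.ne_zero
  have hWtop : W ≠ ⊤ := by
    intro h
    have hinv : (ℓ : K)⁻¹ ∈ W := h ▸ trivial
    rw [hW, map_inv₀, map_inv₀] at hinv
    have h0 : Valued.v (j (ℓ : K)) ≠ 0 := by
      rw [Valuation.ne_zero_iff]; exact (map_ne_zero j).mpr hℓ0
    have : (1 : ℝ≥0) < (Valued.v (j (ℓ : K)))⁻¹ := one_lt_inv_iff₀.mpr ⟨pos_iff_ne_zero.mpr h0, hjℓ⟩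
    exact absurd hinv (not_le.mpr this)
  -- `(𝓞 K)_v ≤ W`
  have hle : HeightOneSpectrum.valuationSubringAtPrime K v ≤ W := by
    rintro x ⟨a, s, hs, rfl⟩
    rw [hW]
    have hs1 : Valued.v (j ((s : 𝓞 K) : K)) = 1 :=
      le_antisymm (hj s) (not_lt.mp fun h ↦ hs ((hjv s).mp h))
    have key : Valued.v (j ((a : K) * ((s : 𝓞 K) : K)⁻¹)) ≤ 1 := by
      rw [map_mul, map_inv₀, map_mul, map_inv₀, hs1, inv_one, mul_one]; exact hj a
    exact key
  have hWeq : W = (v.valuation K).valuationSubring := by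
    rw [← HeightOneSpectrum.valuationSubringAtPrime_eq_valuationSubring]
    exact (ValuationSubring.eq_of_le_of_ne_top _ hle hWtop).symm
  rw [← hW, hWeq, Valuation.mem_valuationSubring_iff]

/-- Strict version of `valued_le_one_iff_valuation_le_one`: `|j x| < 1 ↔ v(x) < 1` (apply the
non-strict version to `x⁻¹`). [cite: NeukirchANT1999, Ch. II (8.1)] -/
theorem valued_lt_one_iff_valuation_lt_one (j : K →+* PadicAlgCl ℓ) (v : HeightOneSpectrum (𝓞 K))
    (hℓv : ((ℓ : ℕ) : 𝓞 K) ∈ v.asIdeal)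
    (hj : ∀ r : 𝓞 K, Valued.v (j r) ≤ 1) (hjv : ∀ r : 𝓞 K, Valued.v (j r) < 1 ↔ r ∈ v.asIdeal)
    (x : K) : Valued.v (j x) < 1 ↔ v.valuation K x < 1 := by
  by_cases hx : x = 0
  · subst hx; simp
  have h := valued_le_one_iff_valuation_le_one j v hℓv hj hjv x⁻¹
  simp only [map_inv₀] at h
  have h1 : 0 < Valued.v (j x) := (Valuation.pos_iff _).mpr ((map_ne_zero j).mpr hx)
  have h2 : 0 < v.valuation K x := (Valuation.pos_iff _).mpr hx
  rw [inv_le_one₀ h1, inv_le_one₀ h2] at h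
  simpa only [not_le] using not_congr h

end Place

/-! ### Every finite place above `ℓ` of a number field is induced by an embedding into `ℚ̄_ℓ` -/

section Embedding

variable {ℓ : ℕ} [Fact ℓ.Prime]

/-- Elements of `ℚ̄_ℓ` integral over `ℤ` lie in `ℤ̄_ℓ` (valuation rings are integrally closed,
Mathlib `Valuation.Integers.mem_of_integral`). [folklore] -/
theorem mem_padicAlgClIntegers_of_isIntegral {x : PadicAlgCl ℓ} (hx : IsIntegral ℤ x) :
    x ∈ padicAlgClIntegers ℓ := by
  have hx' : IsIntegral (Valued.v : Valuation (PadicAlgCl ℓ) ℝ≥0).integer x := hx.tower_top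
  have := Valuation.Integers.mem_of_integral (Valuation.integer.integers
    (Valued.v : Valuation (PadicAlgCl ℓ) ℝ≥0)) hx'
  rw [Valuation.mem_integer_iff] at this
  exact (Valuation.mem_valuationSubring_iff _ _).mpr this

/-- Membership in the maximal ideal of `ℤ̄_ℓ` is `|x| < 1` (units of the valuation ring are the
elements of valuation `1`). [folklore] -/
theorem mem_maximalIdeal_padicAlgClIntegers_iff (x : padicAlgClIntegers ℓ) :
    x ∈ maximalIdeal (padicAlgClIntegers ℓ) ↔ Valued.v (x : PadicAlgCl ℓ) < 1 := by
  rw [IsLocalRing.mem_maximalIdeal, mem_nonunits_iff]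
  have hx : Valued.v (x : PadicAlgCl ℓ) ≤ 1 := (Valuation.mem_valuationSubring_iff _ _).mp x.2
  constructor
  · intro hnu
    refine lt_of_le_of_ne hx fun h1 ↦ hnu ?_
    have hx0 : (x : PadicAlgCl ℓ) ≠ 0 := by
      intro h0
      rw [h0, map_zero] at h1
      exact zero_ne_one h1
    have hinv : (x : PadicAlgCl ℓ)⁻¹ ∈ padicAlgClIntegers ℓ := by
      rw [Valuation.mem_valuationSubring_iff, map_inv₀, h1, inv_one]
    exact isUnit_iff_exists_inv.mpr ⟨⟨_, hinv⟩, Subtype.ext (mul_inv_cancel₀ hx0)⟩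
  · rintro hlt ⟨u, hu⟩
    have h1 : Valued.v ((u : padicAlgClIntegers ℓ) : PadicAlgCl ℓ) *
        Valued.v (((u⁻¹ : (padicAlgClIntegers ℓ)ˣ) : padicAlgClIntegers ℓ) : PadicAlgCl ℓ) = 1 := by
      rw [← map_mul, ← Subring.coe_mul]
      have := congrArg (fun y : padicAlgClIntegers ℓ ↦ Valued.v (y : PadicAlgCl ℓ)) u.mul_inv
      simpa only [Units.val_one, OneMemClass.coe_one, map_one] using this
    have h2 : Valued.v (((u⁻¹ : (padicAlgClIntegers ℓ)ˣ) : padicAlgClIntegers ℓ) : PadicAlgCl ℓ) ≤ 1 :=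
      (Valuation.mem_valuationSubring_iff _ _).mp (SetLike.coe_mem _)
    rw [hu] at h1
    have h3 : 1 ≤ Valued.v (x : PadicAlgCl ℓ) := by
      by_contra h
      rw [not_le] at h
      have := mul_lt_one_of_lt_of_le h h2
      rw [h1] at this
      exact lt_irrefl _ this
    exact absurd hlt (not_lt.mpr h3)

variable {K : Type} [Field K] [NumberField K]

/-- **Every prime `v ∣ ℓ` of a number field `K` is induced by an embedding `K ↪ ℚ̄_ℓ`**: there is
`j : K →+* ℚ̄_ℓ` with `j(𝓞 K) ⊆ ℤ̄_ℓ` and `j⁻¹(𝔪_{ℤ̄_ℓ}) ∩ 𝓞 K = v`. Proof: embed `ℚ̄ ↪ ℚ̄_ℓ`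
and `K ↪ ℚ̄`; the prime `𝔓₀ = 𝔪 ∩ ℤ̄` of `ℤ̄` and a prime `𝔔` of `ℤ̄` above `v` both lie over
`(ℓ)`, so `σ 𝔔 = 𝔓₀` for some `σ ∈ Gal(ℚ̄/ℚ)` (transitivity), and `j = (ℚ̄ ↪ ℚ̄_ℓ) ∘ σ ∘ (K ↪ ℚ̄)`
works. Neukirch, *Algebraic Number Theory*, Ch. II (8.1)–(8.2) (extensions of `|·|_ℓ` to `K` ↔
primes above `ℓ` ↔ embeddings `K → ℚ̄_ℓ` up to conjugacy) with Ch. I (9.1) (transitivity).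
[cite: NeukirchANT1999, Ch. II (8.1)–(8.2) and Ch. I (9.1)] -/
theorem exists_ringHom_padicAlgCl_of_heightOneSpectrum (v : HeightOneSpectrum (𝓞 K))
    (hℓv : ((ℓ : ℕ) : 𝓞 K) ∈ v.asIdeal) :
    ∃ j : K →+* PadicAlgCl ℓ, (∀ r : 𝓞 K, Valued.v (j r) ≤ 1) ∧
      ∀ r : 𝓞 K, Valued.v (j r) < 1 ↔ r ∈ v.asIdeal := by
  classical
  have hℓ : ℓ.Prime := Fact.out
  -- `ℚ̄ ↪ ℚ̄_ℓ` and `K ↪ ℚ̄`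
  haveI : Algebra.IsAlgebraic ℚ (AlgebraicClosure ℚ) := by
    convert AlgebraicClosure.isAlgebraic ℚ
    all_goals rfl
  let φ₀ : (AlgebraicClosure ℚ) →ₐ[ℚ] PadicAlgCl ℓ := IsAlgClosed.lift
  let e₀ : K →ₐ[ℚ] (AlgebraicClosure ℚ) := IsAlgClosed.lift
  -- `ℤ̄ → ℤ̄_ℓ`
  have hφint : ∀ x : (absIntegers (𝓞 ℚ) ℚ), φ₀ (x : (AlgebraicClosure ℚ)) ∈ padicAlgClIntegers ℓ := by
    intro x
    apply mem_padicAlgClIntegers_of_isIntegral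
    have h1 : IsIntegral (𝓞 ℚ) (x : (AlgebraicClosure ℚ)) := x.2
    have h2 : IsIntegral ℤ (x : (AlgebraicClosure ℚ)) := isIntegral_trans (R := ℤ) _ h1
    exact h2.map φ₀.toRingHom.toIntAlgHom
  let ψ₀ : (absIntegers (𝓞 ℚ) ℚ) →+* padicAlgClIntegers ℓ :=
    { toFun := fun x ↦ ⟨φ₀ (x : (AlgebraicClosure ℚ)), hφint x⟩
      map_one' := Subtype.ext (by simp)
      map_mul' := fun x y ↦ Subtype.ext (by simp)
      map_zero' := Subtype.ext (by simp)
      map_add' := fun x y ↦ Subtype.ext (by simp) }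
  have hψ₀ : ∀ x : (absIntegers (𝓞 ℚ) ℚ), ((ψ₀ x : padicAlgClIntegers ℓ) : PadicAlgCl ℓ) = φ₀ (x : (AlgebraicClosure ℚ)) := fun _ ↦ rfl
  let 𝔓₀ : Ideal (absIntegers (𝓞 ℚ) ℚ) := (maximalIdeal (padicAlgClIntegers ℓ)).comap ψ₀
  haveI h𝔓₀ : 𝔓₀.IsPrime := Ideal.IsPrime.comap ψ₀
  have hmem𝔓₀ : ∀ x : (absIntegers (𝓞 ℚ) ℚ), x ∈ 𝔓₀ ↔ Valued.v (φ₀ (x : (AlgebraicClosure ℚ))) < 1 := fun x ↦ by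
    rw [Ideal.mem_comap, mem_maximalIdeal_padicAlgClIntegers_iff, hψ₀]
  -- `𝓞 K → ℤ̄` along `e₀`
  have heint : ∀ r : 𝓞 K, IsIntegral (𝓞 ℚ) (e₀ (r : K)) := by
    intro r
    have h1 : IsIntegral ℤ (e₀ (r : K)) := (r.2 : IsIntegral ℤ (r : K)).map e₀.toRingHom.toIntAlgHom
    exact h1.tower_top
  let f : 𝓞 K →+* (absIntegers (𝓞 ℚ) ℚ) :=
    { toFun := fun r ↦ ⟨e₀ (r : K), heint r⟩
      map_one' := Subtype.ext (by simp)
      map_mul' := fun x y ↦ Subtype.ext (by simp)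
      map_zero' := Subtype.ext (by simp)
      map_add' := fun x y ↦ Subtype.ext (by simp) }
  have hf : ∀ r : 𝓞 K, ((f r : (absIntegers (𝓞 ℚ) ℚ)) : (AlgebraicClosure ℚ)) = e₀ (r : K) := fun _ ↦ rfl
  have hfinj : Function.Injective f := by
    intro x y h
    have := congrArg (fun z : (absIntegers (𝓞 ℚ) ℚ) ↦ (z : (AlgebraicClosure ℚ))) h
    rw [hf, hf] at this
    exact Subtype.ext (e₀.toRingHom.injective this)
  -- a prime `𝔔` of `ℤ̄` above `v`
  letI : Algebra (𝓞 K) (absIntegers (𝓞 ℚ) ℚ) := f.toAlgebra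
  have halg : ∀ r : 𝓞 K, algebraMap (𝓞 K) (absIntegers (𝓞 ℚ) ℚ) r = f r := fun _ ↦ rfl
  haveI : Algebra.IsIntegral (𝓞 K) (absIntegers (𝓞 ℚ) ℚ) := ⟨fun x ↦ by
    have h1 : IsIntegral (𝓞 ℚ) x := integralClosure.isIntegral x
    have h2 : IsIntegral ℤ x := isIntegral_trans (R := ℤ) _ h1
    exact h2.tower_top⟩
  haveI : FaithfulSMul (𝓞 K) (absIntegers (𝓞 ℚ) ℚ) := (faithfulSMul_iff_algebraMap_injective _ _).mpr hfinj
  haveI := v.isMaximal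
  obtain ⟨𝔔, h𝔔max, h𝔔over⟩ :=
    Ideal.exists_maximal_ideal_liesOver_of_isIntegral (S := (absIntegers (𝓞 ℚ) ℚ)) v.asIdeal
  have hmem𝔔 : ∀ r : 𝓞 K, f r ∈ 𝔔 ↔ r ∈ v.asIdeal := fun r ↦ by
    rw [h𝔔over.over, Ideal.under_def, Ideal.mem_comap, halg]
  -- both `𝔓₀` and `𝔔` lie over `(ℓ) ⊂ 𝓞 ℚ`
  have hℓval : Valued.v ((ℓ : ℕ) : PadicAlgCl ℓ) < 1 := by
    rw [PadicAlgCl.valuation_p ℓ, one_div]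
    exact inv_lt_one_of_one_lt₀ (by exact_mod_cast hℓ.one_lt)
  have hℓ𝔓₀ : algebraMap (𝓞 ℚ) (absIntegers (𝓞 ℚ) ℚ) ℓ ∈ 𝔓₀ := by
    rw [hmem𝔓₀, map_natCast]
    simpa using hℓval
  have hℓ𝔔 : algebraMap (𝓞 ℚ) (absIntegers (𝓞 ℚ) ℚ) ℓ ∈ 𝔔 := by
    have h1 : f (ℓ : 𝓞 K) ∈ 𝔔 := (hmem𝔔 _).mpr hℓv
    rw [map_natCast] at h1
    rwa [map_natCast]
  -- `(ℓ)` is maximal in `𝓞 ℚ`, so the two primes under `𝔓₀`, `𝔔` coincide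
  have hspan_max : (Ideal.span {((ℓ : ℕ) : 𝓞 ℚ)}).IsMaximal := by
    have hprime : Prime ((ℓ : ℕ) : 𝓞 ℚ) := by
      rw [← MulEquiv.prime_iff Rat.ringOfIntegersEquiv, map_natCast]
      exact Nat.prime_iff_prime_int.mp hℓ
    have hne : ((ℓ : ℕ) : 𝓞 ℚ) ≠ 0 := hprime.ne_zero
    haveI : (Ideal.span {((ℓ : ℕ) : 𝓞 ℚ)}).IsPrime := (Ideal.span_singleton_prime hne).mpr hprime
    exact Ideal.IsPrime.isMaximal inferInstance (by rw [Ne, Ideal.span_singleton_eq_bot]; exact hne)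
  have hunder : ∀ (P : Ideal (absIntegers (𝓞 ℚ) ℚ)) [P.IsPrime], algebraMap (𝓞 ℚ) (absIntegers (𝓞 ℚ) ℚ) ℓ ∈ P →
      P.under (𝓞 ℚ) = Ideal.span {((ℓ : ℕ) : 𝓞 ℚ)} := by
    intro P _ hP
    symm
    refine hspan_max.eq_of_le (Ideal.IsPrime.under (𝓞 ℚ) P).ne_top ?_
    rw [Ideal.span_le, Set.singleton_subset_iff]
    exact hP
  have heq : 𝔓₀.under (𝓞 ℚ) = 𝔔.under (𝓞 ℚ) := by
    haveI := h𝔔max.isPrime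
    rw [hunder 𝔓₀ hℓ𝔓₀, hunder 𝔔 hℓ𝔔]
  -- the place `w` of `ℚ` under `𝔓₀` and transitivity of `Gal(ℚ̄/ℚ)`
  have hwbot : 𝔓₀.under (𝓞 ℚ) ≠ ⊥ := by
    intro h
    have h1 : ((ℓ : ℕ) : 𝓞 ℚ) ∈ 𝔓₀.under (𝓞 ℚ) := hℓ𝔓₀
    rw [h, Ideal.mem_bot] at h1
    exact hℓ.ne_zero (by exact_mod_cast h1)
  let w : HeightOneSpectrum (𝓞 ℚ) := ⟨𝔓₀.under (𝓞 ℚ), inferInstance, hwbot⟩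
  have h𝔓₀w : 𝔓₀ ∈ w.primesAbove := ⟨h𝔓₀, ⟨rfl⟩⟩
  have h𝔔w : 𝔔 ∈ w.primesAbove := ⟨h𝔔max.isPrime, ⟨heq⟩⟩
  obtain ⟨σ, hσ⟩ := HeightOneSpectrum.exists_smul_eq_of_mem_primesAbove_holds h𝔔w h𝔓₀w
  -- the embedding
  let jK : K →+* PadicAlgCl ℓ :=
    φ₀.toRingHom.comp ((MulSemiringAction.toRingHom (absoluteGaloisGroup ℚ) (AlgebraicClosure ℚ) σ).comp e₀.toRingHom)
  have hjK : ∀ r : 𝓞 K, jK r = φ₀ ((σ • f r : (absIntegers (𝓞 ℚ) ℚ)) : (AlgebraicClosure ℚ)) := fun r ↦ by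
    rw [integralClosure.coe_smul, hf]
    rfl
  refine ⟨jK, fun r ↦ ?_, fun r ↦ ?_⟩
  · rw [hjK]
    exact (Valuation.mem_valuationSubring_iff _ _).mp (hφint _)
  · rw [hjK, ← hmem𝔓₀, ← hσ, Ideal.smul_mem_pointwise_smul_iff, hmem𝔔]

end Embedding

/-! ### 6.12–6.13 for Deligne's representation over `ℚ̄_ℓ` -/

section Core

variable {N : ℕ} [NeZero N]

set_option maxHeartbeats 1600000 in
/-- **Deligne–Serre 1974, 6.12–6.13 over `ℚ̄_ℓ`.** As `thm67_weightOne_core`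
(`NewformGaloisRepModLProofs`), with Deligne's `λ`-adic representation replaced by a continuous
`ρ : Gal(ℚ̄/ℚ) → GL₂(ℚ̄_ℓ)` and the place `v` of the number field `K ∋ b_p` replaced by an
embedding `jK : K → ℚ̄_ℓ` mapping `𝓞 K` into `ℤ̄_ℓ`: `ρ` is unramified at `p ∤ N ℓ` with
`det(X - ρ(F_p)) = jK(X² - b_p X + c_p p^{k'-1})`, `b_p ≡ a_p(f)` and `ker ι ↦ 𝔪` under `jK ∘ i`.
Conclusion: the conclusion of Thm. 6.7 for `(f, ℓ, ι)`. Proof: integral model over the (open,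
non-Noetherian) valuation ring `ℤ̄_ℓ` (`exists_integralModel_of_valuationSubring`), reduction
modulo `𝔪` (`isOpen_ker_residualRep`), the congruences `b_p ≡ a_p`, `p^{k'-1} ≡ 1 (mod ℓ)`, and
`thm67_weightOne_of_residualModel` ((6.12.1) by Chebotarev, Lemme 6.13 over `ℤ̄_ℓ/𝔪 ⊇ 𝔽_ℓ`,
semisimplification). [cite: DeligneSerreASENS1974, 6.12–6.13 (pp. 522–523)] -/
theorem thm67_weightOne_core_padicAlgCl
    (hCheb : LFunctions.Chebotarev.dirichletDensity_eq.{0})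
    (hL : DeligneSerre1974_span_integralLattice1 N 1)
    {f : CuspForm (Gamma1 N) 1} (hf : IsNewform1 f) (ℓ : ℕ) [Fact ℓ.Prime]
    (ι : coeffCharIntegers f →+* ZMod ℓ)
    {K : Type} [Field K] [NumberField K] (i : coeffCharField f →+* K)
    (jK : K →+* PadicAlgCl ℓ) {k' : ℤ} (hk' : 2 ≤ k') (hℓk' : ((ℓ : ℤ) - 1 ∣ k' - 1))
    (b c : ℕ → K)
    (hjint : ∀ r : 𝓞 K, Valued.v (jK r) ≤ 1)
    (hker : ∀ y : coeffCharIntegers f, ι y = 0 → Valued.v (jK (i y)) < 1)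
    (hbint : ∀ p : ℕ, Valued.v (jK (b p)) ≤ 1)
    (hbcongr : ∀ p : ℕ, p.Prime → ¬ p ∣ N * ℓ →
      Valued.v (jK (b p - i ⟨cuspCoeff f p, cuspCoeff_mem_coeffCharField f p⟩)) < 1)
    (hc : ∀ p : ℕ, p.Prime → ¬ p ∣ N * ℓ →
      c p = i ⟨(nebentypus f (p : ZMod N) : ℂ), nebentypus_mem_coeffCharField f p⟩)
    (ρ : GaloisRepresentations.FramedGaloisRep ℚ (PadicAlgCl ℓ) 2)
    (hρ : ∀ w : HeightOneSpectrum (𝓞 ℚ), ¬ ((primesEquiv w : Nat.Primes) : ℕ) ∣ N * ℓ →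
      ρ.IsUnramifiedAt w ∧
      ρ.HasFrobCharpolyAt w
        ((X ^ 2 - C (b ((primesEquiv w : Nat.Primes) : ℕ)) * X +
          C (c ((primesEquiv w : Nat.Primes) : ℕ) *
            (((primesEquiv w : Nat.Primes) : ℕ) : K) ^ (k' - 1))).map jK)) :
    ∃ ρbar : GaloisRepresentations.FramedGaloisRep ℚ (ZMod ℓ) 2,
      IsGaloisRepOfNewform1Int f ι {p | p ∣ N * ℓ} ρbar ∧ ρbar.toGaloisRep.IsSemisimple := by
  classical
  have hℓ : ℓ.Prime := Fact.out
  haveI : NeZero (N * ℓ) := ⟨mul_ne_zero (NeZero.ne N) hℓ.ne_zero⟩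
  set ε : DirichletCharacter ℂ N := nebentypus f with hεdef
  -- ### 6.12: integral model over `ℤ̄_ℓ` and reduction modulo `𝔪`
  have hOopen : IsOpen ((padicAlgClIntegers ℓ : ValuationSubring (PadicAlgCl ℓ)) : Set (PadicAlgCl ℓ)) :=
    Valued.isOpen_valuationSubring _
  obtain ⟨P, ρ₀, hρ₀⟩ :=
    GaloisRepresentations.exists_integralModel_of_valuationSubring (O := padicAlgClIntegers ℓ) hOopen ρ
  have hmemO : ∀ x : PadicAlgCl ℓ, x ∈ (padicAlgClIntegers ℓ) ↔ Valued.v x ≤ 1 := fun x ↦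
    Valuation.mem_valuationSubring_iff _ _
  have hmax : {x : PadicAlgCl ℓ | ∃ h : x ∈ padicAlgClIntegers ℓ,
      (⟨x, h⟩ : padicAlgClIntegers ℓ) ∈ maximalIdeal (padicAlgClIntegers ℓ)} =
      {x : PadicAlgCl ℓ | Valued.v x < 1} := by
    ext x
    constructor
    · rintro ⟨hx, hm⟩
      have h := (mem_maximalIdeal_padicAlgClIntegers_iff ⟨x, hx⟩).mp hm
      exact h
    · intro hx
      exact ⟨(hmemO x).mpr hx.le, (mem_maximalIdeal_padicAlgClIntegers_iff _).mpr hx⟩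
  have hmopen : IsOpen {x : PadicAlgCl ℓ | ∃ h : x ∈ padicAlgClIntegers ℓ,
      (⟨x, h⟩ : padicAlgClIntegers ℓ) ∈ maximalIdeal (padicAlgClIntegers ℓ)} := by
    rw [hmax]
    have hball : {x : PadicAlgCl ℓ | Valued.v x < 1} = Metric.ball (0 : PadicAlgCl ℓ) 1 := by
      ext x
      simp only [Set.mem_setOf_eq, Metric.mem_ball, dist_zero_right]
      rw [PadicAlgCl.valuation_def, ← NNReal.coe_lt_coe, coe_nnnorm, NNReal.coe_one]
    rw [hball]
    exact Metric.isOpen_ball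
  set φbar : absoluteGaloisGroup ℚ →* GL (Fin 2) (ResidueField (padicAlgClIntegers ℓ)) :=
    (Matrix.GeneralLinearGroup.map (residue (padicAlgClIntegers ℓ))).comp ρ₀ with hφbar
  have hφker : IsOpen (φbar.ker : Set (absoluteGaloisGroup ℚ)) :=
    GaloisRepresentations.isOpen_ker_residualRep hmopen hρ₀
  -- ### bookkeeping: the exponent
  obtain ⟨m, hm⟩ : ∃ m : ℕ, k' - 1 = m := ⟨(k' - 1).toNat, (Int.toNat_of_nonneg (by omega)).symm⟩
  have hℓm : (ℓ - 1) ∣ m := by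
    have h1 : ((ℓ : ℤ) - 1) ∣ (m : ℤ) := hm ▸ hℓk'
    have h2 : ((ℓ - 1 : ℕ) : ℤ) = (ℓ : ℤ) - 1 := by rw [Nat.cast_sub hℓ.one_le, Nat.cast_one]
    rw [← h2] at h1
    exact Int.natCast_dvd_natCast.mp h1
  have hιsurj : Function.Surjective ι := ZMod.ringHom_surjective ι
  -- ### elements of `ℤ̄_ℓ` coming from `K`, and their residues
  let toO : ∀ x : K, Valued.v (jK x) ≤ 1 → (padicAlgClIntegers ℓ) := fun x hx ↦ ⟨jK x, (hmemO _).mpr hx⟩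
  have htoO_coe : ∀ x hx, ((toO x hx : (padicAlgClIntegers ℓ)) : PadicAlgCl ℓ) = jK x := fun _ _ ↦ rfl
  have htoO_res : ∀ x hx, Valued.v (jK x) < 1 → residue (padicAlgClIntegers ℓ) (toO x hx) = 0 := by
    intro x hx hlt
    rw [residue_eq_zero_iff]
    exact (mem_maximalIdeal_padicAlgClIntegers_iff (toO x hx)).mpr hlt
  have htoO_sub : ∀ x y hx hy hxy, toO x hx - toO y hy = toO (x - y) hxy :=
    fun x y hx hy hxy ↦ Subtype.ext (by
      change jK x - jK y = jK (x - y); rw [map_sub])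
  have htoO_mul : ∀ x y hx hy hxy, toO x hx * toO y hy = toO (x * y) hxy :=
    fun x y hx hy hxy ↦ Subtype.ext (by
      change jK x * jK y = jK (x * y); rw [map_mul])
  have htoO_pow : ∀ x hx n hxn, toO x hx ^ n = toO (x ^ n) hxn :=
    fun x hx n hxn ↦ Subtype.ext (by
      change jK x ^ n = jK (x ^ n); rw [map_pow])
  have htoO_nat : ∀ (n : ℕ) hn, toO (n : K) hn = (n : (padicAlgClIntegers ℓ)) := fun n hn ↦ Subtype.ext (by
    change jK n = ((n : (padicAlgClIntegers ℓ)) : PadicAlgCl ℓ); rw [map_natCast]; norm_cast)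
  have hint_alg : ∀ r : 𝓞 K, Valued.v (jK (r : K)) ≤ 1 := hjint
  -- the map `𝓞_f → ℤ̄_ℓ/𝔪` through `i` and `jK`, which factors through `ι`
  let cmap : coeffCharIntegers f →+* 𝓞 K := coeffCharIntegersMap f i
  have hcmap : ∀ y : coeffCharIntegers f, ((cmap y : 𝓞 K) : K) = i y.1 := fun _ ↦ rfl
  let ψO : 𝓞 K →+* (padicAlgClIntegers ℓ) :=
    { toFun := fun r ↦ toO (r : K) (hint_alg r)
      map_one' := Subtype.ext (by change jK ((1 : 𝓞 K) : K) = 1; simp)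
      map_mul' := fun x y ↦ Subtype.ext (by change jK ((x * y : 𝓞 K) : K) = jK (x : K) * jK (y : K); simp)
      map_zero' := Subtype.ext (by change jK ((0 : 𝓞 K) : K) = 0; simp)
      map_add' := fun x y ↦ Subtype.ext (by change jK ((x + y : 𝓞 K) : K) = jK (x : K) + jK (y : K); simp) }
  have hψO : ∀ r : 𝓞 K, ψO r = toO (r : K) (hint_alg r) := fun _ ↦ rfl
  let ψK : coeffCharIntegers f →+* ResidueField (padicAlgClIntegers ℓ) := (residue (padicAlgClIntegers ℓ)).comp (ψO.comp cmap)
  have hψK : ∀ y, ψK y = residue (padicAlgClIntegers ℓ) (ψO (cmap y)) := fun _ ↦ rfl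
  have hkerle : RingHom.ker ι ≤ RingHom.ker ψK := by
    intro y hy
    rw [RingHom.mem_ker] at hy ⊢
    rw [hψK, hψO]
    exact htoO_res _ (hint_alg (cmap y)) (by rw [hcmap]; exact hker y hy)
  let j : ZMod ℓ →+* ResidueField (padicAlgClIntegers ℓ) :=
    (ι.liftOfRightInverse (Function.surjInv hιsurj) (Function.rightInverse_surjInv hιsurj))
      ⟨ψK, hkerle⟩
  have hj : ∀ y : coeffCharIntegers f, j (ι y) = ψK y := fun y ↦
    RingHom.liftOfRightInverse_comp_apply ι _ _ ⟨ψK, hkerle⟩ y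
  -- ### the integral Hecke polynomial and its reductions
  have hint : ∀ n, IsIntegral ℤ (cuspCoeff f n) := fun n ↦
    IsNewform1.isIntegral_cuspCoeff hL le_rfl hf n
  let aInt : ℕ → coeffCharIntegers f := fun p ↦
    ⟨⟨cuspCoeff f p, cuspCoeff_mem_coeffCharField f p⟩, (isIntegral_coeffCharField_iff f).mpr (hint p)⟩
  let cInt : ℕ → coeffCharIntegers f := fun p ↦
    ⟨⟨(ε (p : ZMod N) : ℂ) * (p : ℂ) ^ ((1 : ℤ) - 1), nebentypus_mul_zpow_mem_coeffCharField f p⟩,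
      (isIntegral_coeffCharField_iff f).mpr (isIntegral_nebentypus_mul_zpow f le_rfl p)⟩
  let εInt : ℕ → coeffCharIntegers f := fun p ↦
    ⟨⟨(ε (p : ZMod N) : ℂ), nebentypus_mem_coeffCharField f p⟩,
      (isIntegral_coeffCharField_iff f).mpr (isIntegral_dirichletCharacter_apply ε _)⟩
  have hcε : ∀ p, cInt p = εInt p := fun p ↦ Subtype.ext (Subtype.ext (by
    change (ε (p : ZMod N) : ℂ) * (p : ℂ) ^ ((1 : ℤ) - 1) = ε (p : ZMod N)
    rw [sub_self, zpow_zero, mul_one]))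
  let Pint : ℕ → Polynomial (coeffCharIntegers f) := fun p ↦ X ^ 2 - C (aInt p) * X + C (cInt p)
  have hPint : ∀ p : ℕ, (Pint p).map (algebraMap (coeffCharIntegers f) (coeffCharField f)) =
      heckePolynomial f p := by
    intro p
    simp only [Pint, heckePolynomial, Polynomial.map_add, Polynomial.map_sub,
      Polynomial.map_mul, Polynomial.map_pow, Polynomial.map_X, Polynomial.map_C]
    rfl
  -- ### Frobenius characteristic polynomials of `φbar` at the good primes
  have hfrobchar : ∀ (w : HeightOneSpectrum (𝓞 ℚ)),
      ¬ ((primesEquiv w : Nat.Primes) : ℕ) ∣ N * ℓ →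
      ∀ 𝔓 ∈ w.primesAbove, ∀ σ : absoluteGaloisGroup ℚ, IsArithFrobAt (𝓞 ℚ) σ 𝔓 →
        ((φbar σ : GL (Fin 2) (ResidueField (padicAlgClIntegers ℓ))) : Matrix (Fin 2) (Fin 2) (ResidueField (padicAlgClIntegers ℓ))).charpoly =
          ((Pint ((primesEquiv w : Nat.Primes) : ℕ)).map ι).map j := by
    intro w hw 𝔓 h𝔓 σ hσ
    set p : ℕ := ((primesEquiv w : Nat.Primes) : ℕ) with hpdef
    have hp : p.Prime := (primesEquiv w).2
    have hpNℓ : ¬ p ∣ N * ℓ := hw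
    have hpℓ : p ≠ ℓ := fun h ↦ hpNℓ (by rw [h]; exact dvd_mul_left ℓ N)
    obtain ⟨-, hchar⟩ := hρ w hpNℓ
    have hcσ := hchar 𝔓 h𝔓 σ hσ
    -- valuations of the coefficients
    have hcKp : c p = i (εInt p).1 := hc p hp hpNℓ
    have hvb : Valued.v (jK (b p)) ≤ 1 := hbint p
    have hvc : Valued.v (jK (c p)) ≤ 1 := by
      rw [hcKp, ← hcmap]; exact hint_alg _
    have hvp : Valued.v (jK (p : K)) ≤ 1 := by
      have := hint_alg (p : 𝓞 K)
      simpa using this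
    have hvpm : Valued.v (jK ((p : K) ^ m)) ≤ 1 := by
      rw [map_pow, map_pow]; exact pow_le_one' hvp m
    have hvcp : Valued.v (jK (c p * (p : K) ^ m)) ≤ 1 := by
      rw [map_mul, map_mul]
      exact mul_le_one' hvc (by have := hvpm; rwa [map_pow, map_pow] at this)
    -- the integral polynomial `Q₀ ∈ ℤ̄_ℓ[X]` and `charpoly (ρ₀ σ) = Q₀`
    let Q₀ : Polynomial (padicAlgClIntegers ℓ) := X ^ 2 - C (toO (b p) hvb) * X + C (toO _ hvcp)
    have hQ₀ : Q₀.map (padicAlgClIntegers ℓ).subtype =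
        ((X ^ 2 - C (b p) * X + C (c p * (p : K) ^ (k' - 1))).map jK) := by
      rw [hm, zpow_natCast]
      simp only [Q₀, Polynomial.map_add, Polynomial.map_sub, Polynomial.map_mul,
        Polynomial.map_pow, Polynomial.map_X, Polynomial.map_C]
      rfl
    have h0 : ((ρ₀ σ : GL (Fin 2) (padicAlgClIntegers ℓ)) : Matrix (Fin 2) (Fin 2) (padicAlgClIntegers ℓ)).charpoly = Q₀ := by
      apply Polynomial.map_injective (padicAlgClIntegers ℓ).subtype Subtype.val_injective
      rw [GaloisRepresentations.charpoly_integralModel hρ₀ σ, hQ₀]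
      exact hcσ
    -- residues of the coefficients
    have hres_b : residue (padicAlgClIntegers ℓ) (toO (b p) hvb) = j (ι (aInt p)) := by
      have hva : Valued.v (jK (i (aInt p).1)) ≤ 1 := by rw [← hcmap]; exact hint_alg _
      have h1 : residue (padicAlgClIntegers ℓ) (toO (b p) hvb) - residue (padicAlgClIntegers ℓ) (toO (i (aInt p).1) hva) = 0 := by
        rw [← map_sub, htoO_sub (b p) (i (aInt p).1) hvb hva ((hbcongr p hp hpNℓ).le)]
        exact htoO_res (b p - i (aInt p).1) ((hbcongr p hp hpNℓ).le) (hbcongr p hp hpNℓ)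
      rw [sub_eq_zero] at h1
      rw [h1, hj, hψK, hψO]
      congr 1
    have hres_c : residue (padicAlgClIntegers ℓ) (toO _ hvcp) = j (ι (cInt p)) := by
      haveI := Fact.mk hℓ
      have hp0 : (p : ZMod ℓ) ≠ 0 := by
        rw [Ne, ZMod.natCast_eq_zero_iff]
        exact fun h ↦ hpℓ ((Nat.prime_dvd_prime_iff_eq hℓ hp).mp h).symm
      have hpm1 : (p : ZMod ℓ) ^ m = 1 := by
        obtain ⟨c, rfl⟩ := hℓm
        rw [pow_mul, ZMod.pow_card_sub_one_eq_one hp0, one_pow]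
      have hpκ : (residue (padicAlgClIntegers ℓ) (p : (padicAlgClIntegers ℓ))) ^ m = 1 := by
        rw [map_natCast, show (p : ResidueField (padicAlgClIntegers ℓ)) = j (p : ZMod ℓ) from (map_natCast j p).symm,
          ← map_pow, hpm1, map_one]
      have e1 : toO _ hvcp = toO (c p) hvc * (toO (p : K) hvp) ^ m := by
        rw [htoO_pow (p : K) hvp m hvpm]
        exact (htoO_mul (c p) ((p : K) ^ m) hvc hvpm hvcp).symm
      have e2 : toO (c p) hvc = ψO (cmap (εInt p)) := by
        rw [hψO]
        apply Subtype.ext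
        rw [htoO_coe (c p) hvc, htoO_coe _ (hint_alg (cmap (εInt p))), hcKp, hcmap]
      rw [e1, map_mul, map_pow, htoO_nat p hvp, hpκ, mul_one, e2, hcε, hj, hψK]
    rw [GaloisRepresentations.charpoly_residualRep ρ₀ σ, h0]
    simp only [Q₀, Pint, Polynomial.map_add, Polynomial.map_sub, Polynomial.map_mul,
      Polynomial.map_pow, Polynomial.map_X, Polynomial.map_C, hres_b, hres_c]
  -- ### unramified: inertia at `p ∤ N ℓ` dies in `φbar`
  have hsubinj : Function.Injective (Matrix.GeneralLinearGroup.map (n := Fin 2) (padicAlgClIntegers ℓ).subtype) :=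
    generalLinearGroup_map_injective_of_injective (padicAlgClIntegers ℓ).subtype Subtype.val_injective
  have hunr : ∀ w : HeightOneSpectrum (𝓞 ℚ), ¬ ((primesEquiv w : Nat.Primes) : ℕ) ∣ N * ℓ →
      ∀ 𝔓 ∈ w.primesAbove, ∀ σ ∈ 𝔓.inertia (absoluteGaloisGroup ℚ), φbar σ = 1 := by
    intro w hw 𝔓 h𝔓 σ hσ
    obtain ⟨hunr, -⟩ := hρ w hw
    have h1 : ρ σ = 1 := hunr 𝔓 h𝔓 σ hσ
    have h2 : ρ₀ σ = 1 := hsubinj (by rw [hρ₀, h1, mul_one, inv_mul_cancel, map_one])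
    rw [hφbar, MonoidHom.comp_apply, h2, map_one]
  -- ### (6.12.1), Lemme 6.13 over `ℤ̄_ℓ/𝔪 ⊇ 𝔽_ℓ`, semisimplification
  exact thm67_weightOne_of_residualModel hCheb ℓ ι j φbar hφker hunr
    (fun w hw ↦ ⟨Pint _, hPint _, hfrobchar w hw⟩)

end Core

/-! ### Thm. 6.7 in weight one from Deligne's theorem in `ℚ̄_ℓ`-form -/

section Main

variable {N : ℕ} [NeZero N]

set_option maxHeartbeats 1600000 in
/-- **Deligne–Serre 1974, Thm. 6.7 (weight one, `k_λ = 𝔽_ℓ`) from Deligne's theorem in the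
`ℚ̄_ℓ`-form of the Langlands correspondence.** Hypothesis `hD`: for every cuspidal eigenform
`g ∈ S_k(Γ₁(M), χ)` of weight `k ≥ 2` of the `T_p`, `p ∤ M`, with eigenvalues `a_p ∈ ℂ`, every
prime `ℓ` and every field isomorphism `ι : ℚ̄_ℓ ≃ ℂ`, there is a continuous semisimple
`r : Gal(ℚ̄/ℚ) → GL₂(ℚ̄_ℓ)`, unramified at the primes `p ∤ M`, `p ≠ ℓ`, whose arithmetic
Frobenii there have characteristic polynomial `X² - ι⁻¹(a_p) X + ι⁻¹(χ(p) p^{k-1})` — Deligne's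
Thm. 6.1 (op. cit.; Deligne, Sém. Bourbaki 355) read in `ℚ̄_ℓ` through `ι` (for the place `λ`
of `K = ℚ(a_p, χ)` induced by `ι⁻¹`, `r = ρ_{g,λ} ⊗_{K_λ} ℚ̄_ℓ`), which is also the `n = 2`,
`K = ℚ`, holomorphic case of the tree's `exists_galoisRep_of_regularAlgebraic` (lang.S27;
Harris–Lan–Taylor–Thorne, Thm. A) once the newform `g` is read as a regular algebraic cuspidal
automorphic representation of `GL₂(𝔸_ℚ)`. Conclusion: the named fact `thm67_weightOne`.
Proof = op. cit. 6.8–6.13: the lift `g` of `f mod λ` (`exists_eigenform_congr_of_weight_one`,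
6.8–6.11) with its number field `K ∋ b_p`, embedding `e : K → ℂ` and place `v ∣ λ`; an embedding
`jK : K → ℚ̄_ℓ` inducing `v` (`exists_ringHom_padicAlgCl_of_heightOneSpectrum`: transitivity of
`Gal(ℚ̄/ℚ)` on the primes of `ℤ̄` above `ℓ`); an isomorphism `ι : ℚ̄_ℓ ≃ ℂ` with `ι ∘ jK = e`
(`exists_ringEquiv_padicAlgCl_complex_extends`, Steinitz); `hD` for `g` and this `ι`; and
6.12–6.13 over `ℤ̄_ℓ` (`thm67_weightOne_core_padicAlgCl`).
[cite: DeligneSerreASENS1974, Thm. 6.7, Thm. 6.1, 6.8–6.13 and §8.2] -/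
theorem thm67_weightOne_of_deligne_padicAlgCl
    (hD : ∀ (M : ℕ) [NeZero M] (k : ℤ), 2 ≤ k →
      ∀ (g : CuspForm (Gamma1 M) k) (χ : DirichletCharacter ℂ M),
        g ∈ nebentypusSubspace M k χ → g ≠ 0 →
      ∀ (a : ℕ → ℂ),
        (∀ (p : ℕ) (hp : p.Prime), ¬ p ∣ M →
          (haveI : NeZero p := ⟨hp.ne_zero⟩; heckeT (Gamma1 M) k p g) = a p • g) →
      ∀ (ℓ : ℕ) [Fact ℓ.Prime] (ι : PadicAlgCl ℓ ≃+* ℂ),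
        ∃ r : GaloisRepresentations.FramedGaloisRep ℚ (PadicAlgCl ℓ) 2,
          r.toGaloisRep.IsSemisimple ∧
          ∀ w : HeightOneSpectrum (𝓞 ℚ), ¬ ((primesEquiv w : Nat.Primes) : ℕ) ∣ M →
            ((primesEquiv w : Nat.Primes) : ℕ) ≠ ℓ →
            r.IsUnramifiedAt w ∧
            r.HasFrobCharpolyAt w
              (X ^ 2 - C (ι.symm (a ((primesEquiv w : Nat.Primes) : ℕ))) * X +
                C (ι.symm (χ ((primesEquiv w : Nat.Primes) : ℕ) *
                  (((primesEquiv w : Nat.Primes) : ℕ) : ℂ) ^ (k - 1)))))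
    (hCheb : LFunctions.Chebotarev.dirichletDensity_eq.{0})
    (hL : DeligneSerre1974_span_integralLattice1 N 1) :
    thm67_weightOne (N := N) := by
  intro f hf ℓ _ ι
  classical
  have hℓ : ℓ.Prime := Fact.out
  -- ### 6.8–6.11: the eigenform `g` of weight `k' ≥ 2` at level `N ℓ`
  obtain ⟨K, _, _, e, i, v, k', g, b, hei, hk', hℓk', hg0, hgW, hgT, hker, hbint, hbcongr⟩ :=
    exists_eigenform_congr_of_weight_one hL hf ℓ ι
  haveI : NeZero (N * ℓ) := ⟨mul_ne_zero (NeZero.ne N) hℓ.ne_zero⟩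
  set ε : DirichletCharacter ℂ N := nebentypus f with hεdef
  set χ : DirichletCharacter ℂ (N * ℓ) := DirichletCharacter.changeLevel (dvd_mul_right N ℓ) ε
    with hχdef
  -- the values of `χ` lie in `K_f`
  have hχmem : ∀ d : ZMod (N * ℓ), χ d ∈ coeffCharField f := by
    intro d
    by_cases hd : IsUnit d
    · obtain ⟨u, rfl⟩ := hd
      rw [hχdef, DirichletCharacter.changeLevel_eq_cast_of_dvd ε (dvd_mul_right N ℓ) u,
        ← ZMod.natCast_zmod_val (ZMod.cast (u : ZMod (N * ℓ)) : ZMod N)]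
      exact nebentypus_mem_coeffCharField f _
    · rw [MulChar.map_nonunit χ hd]; exact zero_mem _
  let cK : ZMod (N * ℓ) → K := fun d ↦ i ⟨χ d, hχmem d⟩
  have hcK : ∀ d, e (cK d) = χ d := fun d ↦ hei _
  -- ### `ℓ ∈ v`, an embedding `jK : K → ℚ̄_ℓ` inducing `v`, and `ι_ℓ : ℚ̄_ℓ ≃ ℂ` over `K`
  have hℓv : ((ℓ : ℕ) : 𝓞 K) ∈ v.asIdeal := by
    have h1 := hker (ℓ : coeffCharIntegers f) (by rw [map_natCast, ZMod.natCast_self])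
    rw [show (((ℓ : coeffCharIntegers f) : coeffCharField f)) = (ℓ : coeffCharField f) by simp,
      map_natCast] at h1
    rw [← v.valuation_lt_one_iff_mem (K := K)]
    simpa using h1
  obtain ⟨jK, hjint, hjv⟩ := exists_ringHom_padicAlgCl_of_heightOneSpectrum v hℓv
  obtain ⟨ιℓ, hιℓ⟩ := exists_ringEquiv_padicAlgCl_complex_extends jK e
  have hιsymm : ∀ x : K, ιℓ.symm (e x) = jK x := fun x ↦ by
    rw [← hιℓ x, RingEquiv.symm_apply_apply]
  -- ### Deligne's theorem at level `N ℓ`, through `ι_ℓ`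
  obtain ⟨r, -, hr⟩ := hD (N * ℓ) k' hk' g χ hgW hg0 (fun p ↦ e (b p)) hgT ℓ ιℓ
  -- ### 6.12–6.13 over `ℤ̄_ℓ`
  refine thm67_weightOne_core_padicAlgCl hCheb hL hf ℓ ι i jK hk' hℓk' b
    (fun p ↦ cK (p : ZMod (N * ℓ))) hjint (fun y hy ↦ ?_) (fun p ↦ ?_) (fun p hp hpNℓ ↦ ?_)
    (fun p hp hpNℓ ↦ ?_) r (fun w hw ↦ ?_)
  · exact (valued_lt_one_iff_valuation_lt_one jK v hℓv hjint hjv _).mpr (hker y hy)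
  · exact (valued_le_one_iff_valuation_le_one jK v hℓv hjint hjv _).mpr (hbint p)
  · exact (valued_lt_one_iff_valuation_lt_one jK v hℓv hjint hjv _).mpr (hbcongr p hp hpNℓ)
  · have hcop : IsCoprime (p : ℤ) ((N * ℓ : ℕ) : ℤ) :=
      Nat.isCoprime_iff_coprime.mpr ((Nat.Prime.coprime_iff_not_dvd hp).mpr hpNℓ)
    have hχp : χ (p : ZMod (N * ℓ)) = ε (p : ZMod N) := by
      have := DirichletCharacter.changeLevel_eq_cast_of_dvd' ε (dvd_mul_right N ℓ) hcop
      simpa using this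
    change i ⟨χ (p : ZMod (N * ℓ)), hχmem _⟩ = i _
    congr 1
    exact Subtype.ext hχp
  · set p : ℕ := ((primesEquiv w : Nat.Primes) : ℕ) with hpdef
    have hp : p.Prime := (primesEquiv w).2
    have hpℓ : p ≠ ℓ := fun h ↦ hw (by rw [h]; exact dvd_mul_left ℓ N)
    obtain ⟨hunr, hchar⟩ := hr w hw hpℓ
    refine ⟨hunr, ?_⟩
    have hpoly : (X ^ 2 - C (ιℓ.symm (e (b p))) * X +
        C (ιℓ.symm (χ (p : ZMod (N * ℓ)) * ((p : ℕ) : ℂ) ^ (k' - 1))) : Polynomial (PadicAlgCl ℓ)) =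
        (X ^ 2 - C (b p) * X + C (cK (p : ZMod (N * ℓ)) * ((p : ℕ) : K) ^ (k' - 1))).map jK := by
      have h1 : χ (p : ZMod (N * ℓ)) * ((p : ℕ) : ℂ) ^ (k' - 1) =
          e (cK (p : ZMod (N * ℓ)) * ((p : ℕ) : K) ^ (k' - 1)) := by
        rw [map_mul, map_zpow₀, hcK, map_natCast e]
      rw [h1, hιsymm, hιsymm]
      simp only [Polynomial.map_add, Polynomial.map_sub, Polynomial.map_mul,
        Polynomial.map_pow, Polynomial.map_X, Polynomial.map_C]
    have hcast : ((p : ZMod (N * ℓ)) : ZMod (N * ℓ)) = ((p : ℕ) : ZMod (N * ℓ)) := rfl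
    rw [← hpoly]
    exact hchar

/-- **Thm. 6.7 in weight one from Deligne's theorem in `ℚ̄_ℓ`-form, one hypothesis.** As
`thm67_weightOne_of_deligne_padicAlgCl`, with Chebotarev (`dirichletDensity_eq_holds`) and
(2.7.2) (`DeligneSerre1974_span_integralLattice1_holds`) discharged by the tree: hence
`thm67_weightOne_holds` is `thm67_weightOne_of_deligne_padicAlgCl' h` for any proof `h` of
Deligne's theorem in this form (in particular one obtained from
`exists_galoisRep_of_regularAlgebraic` and the adelic dictionary for holomorphic newforms).
[cite: DeligneSerreASENS1974, Thm. 6.7, Thm. 6.1 and §8.2] -/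
theorem thm67_weightOne_of_deligne_padicAlgCl'
    (hD : ∀ (M : ℕ) [NeZero M] (k : ℤ), 2 ≤ k →
      ∀ (g : CuspForm (Gamma1 M) k) (χ : DirichletCharacter ℂ M),
        g ∈ nebentypusSubspace M k χ → g ≠ 0 →
      ∀ (a : ℕ → ℂ),
        (∀ (p : ℕ) (hp : p.Prime), ¬ p ∣ M →
          (haveI : NeZero p := ⟨hp.ne_zero⟩; heckeT (Gamma1 M) k p g) = a p • g) →
      ∀ (ℓ : ℕ) [Fact ℓ.Prime] (ι : PadicAlgCl ℓ ≃+* ℂ),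
        ∃ r : GaloisRepresentations.FramedGaloisRep ℚ (PadicAlgCl ℓ) 2,
          r.toGaloisRep.IsSemisimple ∧
          ∀ w : HeightOneSpectrum (𝓞 ℚ), ¬ ((primesEquiv w : Nat.Primes) : ℕ) ∣ M →
            ((primesEquiv w : Nat.Primes) : ℕ) ≠ ℓ →
            r.IsUnramifiedAt w ∧
            r.HasFrobCharpolyAt w
              (X ^ 2 - C (ι.symm (a ((primesEquiv w : Nat.Primes) : ℕ))) * X +
                C (ι.symm (χ ((primesEquiv w : Nat.Primes) : ℕ) *
                  (((primesEquiv w : Nat.Primes) : ℕ) : ℂ) ^ (k - 1))))) :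
    thm67_weightOne (N := N) :=
  thm67_weightOne_of_deligne_padicAlgCl hD LFunctions.Chebotarev.dirichletDensity_eq_holds
    (DeligneSerre1974_span_integralLattice1_holds N 1)

end Main

end Literature.NumberTheory.EllipticCurves.ModularForms.DeligneSerre1974
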